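import Summits.BirchSwinnertonDyer.BirchSwinnertonDyer.Theorems.PrintCFramBottomClassIndexLawFiveLeBorelVisibleCebotarev
import Summits.BirchSwinnertonDyer.BirchSwinnertonDyer.Theorems.PrintCFramBottomClassIndexLawFiveLeBorelHomothetyLevelP
import HarnessLib

/-!
# Route `PrintCFram`, crux C2 `BottomClassIndexLawFiveLe` (stmt-BirchSwinnertonDyer-20372), line
# `eisenstein-resource-bdp-line`, stub `stub_kolyvaginUpper_borelCM_pairSum_offKrizLi`:
# **TOP-LAYER INDEPENDENCE IS AUTOMATIC ACROSS (SIGN, DEPTH-PARITY) CLASSES, I — RELATIONS SPLIT ALONG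
# CLASSES** (the hypothesis `hind` of the Borel `cebotarev` axiom, FILE 7
# `exists_kolyvaginPrime_gt_pow_cebotarevShape_of_cmRamified`, reduces to independence INSIDE each class;
# two files: I this one = §§1–2, II `…BorelTopLayerIndependenceHind` = §3)
# (cell `bsd-print-cfram`, seat `bsd-line-cfram-p1-w2` g7; helper `--supports` 20372; 0 facts, 0 defs, 0 sorry)

HONEST FRAMING. Nothing about BSD is proved here, and nothing of the stub itself. FILE 6/7 (w2 g6) give the
Borel Čebotarev prescriptions for a family of `c_*`-eigenclasses `x_i` (signs `ν_i`, exact `𝓞`-depths `e_i`)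
under `hind`: the TOP-LAYER FUNCTIONALS `T_i(ρ) = μ^{e_i−1}[x_i, ρ]` (`ρ ∈ Γ_{K(W[n])}`, values in the line
`ker μ = W[𝔭]`) are `𝔽_p`-independent. This file proves that a linear relation among the `T_i` SPLITS along
the classes of the label (`(−1)^{e_i−1}`, `ν_i`):

* §1 `pow_apply_smul_of_smul_sqrt_eq_neg` — `μ^k(γ P) = (−1)^k γ μ^k(P)` for ANY `γ ∈ Γ_ℚ` negating `√−p`
  (FILE 6's `pow_apply_smul_of_anti` is the case `γ = c₀`); `eq_zero_of_two_zsmul_of_prime_zsmul`,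
  `sum_indicator_eq_zero_of_twist` / `sum_class_eq_zero` — the relation-splitting algebra: if the relation
  module of a family of `p`-torsion-valued functionals (`p` odd) is stable under twisting the coefficients by
  two `±1`-labels, every relation restricts to a relation on each label class.
* §2 `top_conj_eq_of_smul_sqrt_eq_neg` — for `g ∈ Γ_K` acting `𝓞`-ANTILINEARLY (`res g · √−p = −√−p`):
  `T_i(g ρ g⁻¹) = (−1)^{e_i−1} · res g · T_i(ρ)` (tree `h1Eval_conj` + §1); `top_conjGalCMH_eq` — for complex
  conjugation: `T_i(ρ^τ) = ν_i (−1)^{e_i−1} η · T_i(ρ)` (tree `IsLiftOfAut.h1Eval_conjGalCMH_of_eigen` + the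
  graded sign); hence the relation module is stable under the twists `(−1)^{e_i−1}` (`sum_top_twist_parity`)
  and `ν_i` (`sum_top_twist_sign`), and `sum_top_class_eq_zero`: every relation restricts to each class.
* §3 **`hind_of_hind_on_classes`** — FILE 7's `hind` follows from the same statement for coefficient vectors
  supported on ONE (parity, sign) class; **`hind_of_injective_label`** — if no two members with `e_i > 0`
  share a label and each has a non-zero top, `hind` holds outright; **`hind_pair_of_opposite_sign`** — in
  particular for ANY two eigenclasses of opposite signs with exact positive depths (Claim A's `{y, s}`,
  Claim B's `{s, c(ℓ)}`): no independence hypothesis at all. An `𝓞`-antilinear `g ∈ Γ_K` exists as soon as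
  `−p` is not a square in `K` (tree `exists_restrict_smul_eq_neg`).

So, in `…BorelDescentClaimA/B`'s data, shape (B2) is FILE 7 + `hind_pair_of_opposite_sign`, and shape (B3)
needs only `x`/`s` decorrelated (same sign and parity), which the split (B4) arranges by integer subtraction
(not here). THEOREMS ONLY; no definition, no named fact, no `sorry`. BSD is not proved by any of this; no
summit statement is proved by this seat. References: [McCallumLMS1991] §3 (Prop. 3.1, Cor. 3.2);
[GrossLMS1991] §9 (the pairing `[s, ρ]` and its equivariance).
-/

set_option autoImplicit false
-- `…BirchSwinnertonDyer.BirchSwinnertonDyer.Theorems…` is the problem's mandated namespace (D-0017).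
set_option linter.dupNamespace false

noncomputable section

open scoped Classical

namespace Summit.BirchSwinnertonDyer.BirchSwinnertonDyer.Theorems.PrintCFram.BorelKolyvaginPairing

open WeierstrassCurve NumberField IsDedekindDomain Field Literature.NumberTheory.EllipticCurves
  Literature.NumberTheory.GaloisRepresentations Literature.NumberTheory.EllipticCurves.Rank1Residual
  Summit.BirchSwinnertonDyer.BirchSwinnertonDyer.Theorems.PrintCFram.BorelHomothety

/-! ## §1 Algebra: the sign rule for any antilinear element, and relation splitting -/

section Algebra

variable (W : WeierstrassCurve ℚ) (p : ℕ)

/-- **`μ^k (γ P) = (−1)^k γ μ^k(P)`** for any `γ ∈ Γ_ℚ` with `γ √−p = −√−p` (the sign rule `hanti`,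
iterated). [cite: Rubin1999, Cor. 5.5] -/
theorem pow_apply_smul_of_smul_sqrt_eq_neg {γ : absoluteGaloisGroup ℚ} {s : AlgebraicClosure ℚ}
    {μ : AddMonoid.End W.geomPoints}
    (hanti : ∀ g : absoluteGaloisGroup ℚ, g • s = -s → ∀ P, μ (g • P) = -(g • μ P))
    (hγ : γ • s = -s) (k : ℕ) (P : W.geomPoints) :
    (μ ^ k) (γ • P) = ((-1 : ℤ) ^ k) • (γ • (μ ^ k) P) := by
  induction k generalizing P with
  | zero => simp
  | succ k ih =>
    rw [pow_succ_apply, pow_succ_apply, ih, map_zsmul, hanti γ hγ ((μ ^ k) P), pow_succ, ← smul_smul,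
      neg_one_zsmul]

/-- `p • t = 0` and `2 • t = 0` with `p` odd force `t = 0`. [folklore] -/
theorem eq_zero_of_two_zsmul_of_prime_zsmul {A : Type*} [AddCommGroup A] (hp2 : Odd p) {t : A}
    (hpt : (p : ℤ) • t = 0) (h2 : (2 : ℤ) • t = 0) : t = 0 := by
  obtain ⟨k, hk⟩ := hp2
  have : ((p : ℤ) - 2 * k) • t = t := by
    rw [show ((p : ℤ) - 2 * k) = 1 by omega, one_smul]
  rw [← this, sub_smul, hpt, mul_comm, mul_smul, h2, smul_zero, sub_zero]

/-- `a • t = 0` with `t ≠ 0` of prime order `p` forces `p ∣ a`. [folklore] -/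
theorem prime_dvd_of_zsmul_eq_zero {A : Type*} [AddCommGroup A] (hp : p.Prime) {t : A} (ht : t ≠ 0)
    (hpt : (p : ℤ) • t = 0) {a : ℤ} (ha : a • t = 0) : (p : ℤ) ∣ a := by
  by_contra hnd
  have hcop : IsCoprime (p : ℤ) a :=
    (Irreducible.coprime_iff_not_dvd (Nat.prime_iff_prime_int.mp hp).irreducible).mpr hnd
  obtain ⟨u, v, huv⟩ := hcop
  apply ht
  calc t = (u * (p : ℤ) + v * a) • t := by rw [huv, one_smul]
    _ = 0 := by rw [add_smul, mul_smul, mul_smul, hpt, ha, smul_zero, smul_zero, add_zero]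

variable {ι X A : Type*} [Fintype ι] [AddCommGroup A]

/-- **Splitting a relation along one `±1`-label.** Let `T_i : X → A` take `p`-torsion values (`p` odd) and
`lab : ι → {±1}`. If `∑ b_i T_i = 0` and `∑ b_i lab_i T_i = 0` (pointwise), then the relation restricts to
the class `lab = α`: `∑_{lab_i = α} b_i T_i = 0` — written with indicator coefficients. (`2·𝟙_{lab_i = α} =
1 + α·lab_i`.) [folklore] -/
theorem sum_indicator_eq_zero_of_twist (hp2 : Odd p) (T : ι → X → A)
    (hT : ∀ i ρ, (p : ℤ) • T i ρ = 0) {lab : ι → ℤ} (hlab : ∀ i, lab i = 1 ∨ lab i = -1)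
    {b : ι → ℤ} (hb : ∀ ρ, ∑ i, b i • T i ρ = 0) (hbl : ∀ ρ, ∑ i, (b i * lab i) • T i ρ = 0)
    {α : ℤ} (hα : α = 1 ∨ α = -1) (ρ : X) :
    ∑ i, (if lab i = α then b i else 0) • T i ρ = 0 := by
  have hαα : α * α = 1 := by rcases hα with rfl | rfl <;> norm_num
  -- `∑ b_i (1 + α lab_i) T_i = 0`
  have hsum : ∑ i, (b i * (1 + α * lab i)) • T i ρ = 0 := by
    have : ∑ i, (b i * (1 + α * lab i)) • T i ρ = ∑ i, b i • T i ρ + α • ∑ i, (b i * lab i) • T i ρ := by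
      rw [Finset.smul_sum, ← Finset.sum_add_distrib]
      refine Finset.sum_congr rfl fun i _ ↦ ?_
      rw [smul_smul, ← add_smul]
      congr 1
      ring
    rw [this, hb ρ, hbl ρ, smul_zero, add_zero]
  -- and `b_i (1 + α lab_i) = 2 · 𝟙 b_i`
  have hcoef : ∀ i, b i * (1 + α * lab i) = 2 * (if lab i = α then b i else 0) := by
    intro i
    by_cases h : lab i = α
    · rw [if_pos h, h, hαα]; ring
    · rw [if_neg h]
      have : α * lab i = -1 := by
        rcases hα with rfl | rfl <;> rcases hlab i with h1 | h1 <;> simp_all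
      rw [this]; ring
  simp_rw [hcoef, mul_smul, ← Finset.smul_sum] at hsum
  refine eq_zero_of_two_zsmul_of_prime_zsmul p hp2 ?_ hsum
  rw [Finset.smul_sum]
  refine Finset.sum_eq_zero fun i _ ↦ ?_
  rw [smul_comm, hT, smul_zero]

/-- **Splitting a relation along two `±1`-labels.** If the relation module of the family `T_i` (values
`p`-torsion, `p` odd) is stable under twisting coefficients by `lab₁` and by `lab₂`, then every relation
`∑ a_i T_i = 0` restricts to each class `{lab₁ = α, lab₂ = β}`. [folklore] -/
theorem sum_class_eq_zero (hp2 : Odd p) (T : ι → X → A) (hT : ∀ i ρ, (p : ℤ) • T i ρ = 0)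
    {lab₁ lab₂ : ι → ℤ} (hlab₁ : ∀ i, lab₁ i = 1 ∨ lab₁ i = -1) (hlab₂ : ∀ i, lab₂ i = 1 ∨ lab₂ i = -1)
    (htw₁ : ∀ b : ι → ℤ, (∀ ρ, ∑ i, b i • T i ρ = 0) → ∀ ρ, ∑ i, (b i * lab₁ i) • T i ρ = 0)
    (htw₂ : ∀ b : ι → ℤ, (∀ ρ, ∑ i, b i • T i ρ = 0) → ∀ ρ, ∑ i, (b i * lab₂ i) • T i ρ = 0)
    {a : ι → ℤ} (ha : ∀ ρ, ∑ i, a i • T i ρ = 0) {α β : ℤ} (hα : α = 1 ∨ α = -1) (hβ : β = 1 ∨ β = -1)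
    (ρ : X) : ∑ i, (if lab₁ i = α ∧ lab₂ i = β then a i else 0) • T i ρ = 0 := by
  -- first restrict to `lab₁ = α`
  set b : ι → ℤ := fun i ↦ if lab₁ i = α then a i else 0 with hb
  have hbrel : ∀ ρ, ∑ i, b i • T i ρ = 0 := fun ρ ↦
    sum_indicator_eq_zero_of_twist p hp2 T hT hlab₁ ha (htw₁ a ha) hα ρ
  -- then to `lab₂ = β`
  have h2 := sum_indicator_eq_zero_of_twist p hp2 T hT hlab₂ hbrel (htw₂ b hbrel) hβ ρ
  convert h2 using 2 with i
  simp only [hb]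
  by_cases h1 : lab₁ i = α <;> by_cases h2' : lab₂ i = β <;> simp [h1, h2']

end Algebra

/-! ## §2 The top functionals under `Γ_K`-conjugation by an antilinear element and under complex conjugation -/

section Tops

variable (W : WeierstrassCurve ℚ) [W.IsElliptic] (p : ℕ) [hp : Fact p.Prime]
variable {K : Type} [Field K] [NumberField K]

omit [W.IsElliptic] hp in
/-- **Top functionals under an antilinear conjugation**: for `g ∈ Γ_K` with `res g · √−p = −√−p`,
`ρ ∈ Γ_{K(W[n])}` and any `k`,
`μ^k [x, g ρ g⁻¹]^♭ = (−1)^k · res g · μ^k [x, ρ]^♭` (`♭` = transport to `W(ℚ̄)`): `Γ_K`-equivariance of the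
pairing (tree `h1Eval_conj`) and the sign rule. [cite: GrossLMS1991, §9 (pairing after Prop. 9.1)] -/
theorem pow_top_conj_eq_of_smul_sqrt_eq_neg {s : AlgebraicClosure ℚ} {μ : AddMonoid.End W.geomPoints}
    (hanti : ∀ g : absoluteGaloisGroup ℚ, g • s = -s → ∀ P, μ (g • P) = -(g • μ P))
    (n : ℤ) (x : galH1Torsion (W.baseChange K) n) {g : absoluteGaloisGroup K}
    (hg : absGaloisRestrict ℚ K g • s = -s) {ρ : absoluteGaloisGroup K}
    (hρ : ρ ∈ torsionFixing (W.baseChange K) n) (k : ℕ) :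
    (μ ^ k) ((RatClosure.torsionEquiv (K := K) W n).symm
        (h1Eval (W.baseChange K) n x (g * ρ * g⁻¹)) : W.geomPoints) =
      ((-1 : ℤ) ^ k) • (absGaloisRestrict ℚ K g •
        (μ ^ k) ((RatClosure.torsionEquiv (K := K) W n).symm (h1Eval (W.baseChange K) n x ρ) :
          W.geomPoints)) := by
  have hE : (RatClosure.torsionEquiv (K := K) W n).symm (h1Eval (W.baseChange K) n x (g * ρ * g⁻¹)) =
      absGaloisRestrict ℚ K g • (RatClosure.torsionEquiv (K := K) W n).symm
        (h1Eval (W.baseChange K) n x ρ) := by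
    apply (RatClosure.torsionEquiv (K := K) W n).injective
    rw [AddEquiv.apply_symm_apply, RatClosure.torsionEquiv_smul, AddEquiv.apply_symm_apply,
      h1Eval_conj _ _ _ _ hρ]
  rw [hE, Literature.NumberTheory.EllipticCurves.AddSubgroup.torsionBy.coe_smul,
    pow_apply_smul_of_smul_sqrt_eq_neg W hanti hg]

omit [W.IsElliptic] in
/-- **Top functionals under complex conjugation**: for a `c_*`-eigenclass `x` of sign `ν` (`c_* x = ν x`),
`ρ ∈ Γ_{K(W[n])}` and any `k`, `μ^k [x, ρ^τ]^♭ = (ν (−1)^k) · c₀ · μ^k [x, ρ]^♭` (tree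
`IsLiftOfAut.h1Eval_conjGalCMH_of_eigen` and the sign rule for `c₀`).
[cite: McCallumLMS1991, §3 proof of Prop. 3.1] -/
theorem pow_top_conjGalCMH_eq_of_eigen {s : AlgebraicClosure ℚ} {μ : AddMonoid.End W.geomPoints}
    (hs : s ^ 2 = ((-(p : ℤ) : ℤ) : AlgebraicClosure ℚ))
    (hanti : ∀ g : absoluteGaloisGroup ℚ, g • s = -s → ∀ P, μ (g • P) = -(g • μ P))
    {c : K ≃ₐ[ℚ] K} {c₀ : absoluteGaloisGroup ℚ} (hc₀ : IsComplexConjugation (Rat.castHom ℝ) c₀)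
    (ht : IsLiftOfAut c (absGaloisTransport (K := ℚ) (L := K) c₀).toRingEquiv)
    (n : ℤ) {x : galH1Torsion (W.baseChange K) n} {ν : ℤ} (hν : ν = 1 ∨ ν = -1)
    (hx : conjAct W c n x = ν • x) {ρ : absoluteGaloisGroup K}
    (hρ : ρ ∈ torsionFixing (W.baseChange K) n) (k : ℕ) :
    (μ ^ k) ((RatClosure.torsionEquiv (K := K) W n).symm
        (h1Eval (W.baseChange K) n x (ht.conjGalCMH ρ)) : W.geomPoints) =
      (ν * (-1 : ℤ) ^ k) • (c₀ •
        (μ ^ k) ((RatClosure.torsionEquiv (K := K) W n).symm (h1Eval (W.baseChange K) n x ρ) :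
          W.geomPoints)) := by
  have hinv : ∀ y, (absGaloisTransport (K := ℚ) (L := K) c₀).toRingEquiv
      ((absGaloisTransport (K := ℚ) (L := K) c₀).toRingEquiv y) = y := fun y ↦
    RatClosure.absGaloisTransport_absGaloisTransport_of_sq_eq_one hc₀.sq_eq_one y
  have hE : (RatClosure.torsionEquiv (K := K) W n).symm (h1Eval (W.baseChange K) n x (ht.conjGalCMH ρ)) =
      ν • (c₀ • (RatClosure.torsionEquiv (K := K) W n).symm (h1Eval (W.baseChange K) n x ρ)) := by
    apply (RatClosure.torsionEquiv (K := K) W n).injective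
    rw [AddEquiv.apply_symm_apply, map_zsmul,
      RatClosure.torsionEquiv_smul_of_lift W ht c₀ (fun _ ↦ rfl) n, AddEquiv.apply_symm_apply,
      ht.h1Eval_conjGalCMH_of_eigen W hinv n hν hx hρ]
  rw [hE, AddSubgroupClass.coe_zsmul, map_zsmul,
    Literature.NumberTheory.EllipticCurves.AddSubgroup.torsionBy.coe_smul,
    pow_apply_smul_of_smul_sqrt_eq_neg W hanti
      (smul_sqrt_eq_neg_of_isComplexConjugation p hp.out.pos hc₀ hs), smul_smul]

omit [W.IsElliptic] hp in
/-- The top value `μ^{e−1}[x, ρ]^♭` of a class whose values are killed by `μ^e` lies on the line `ker μ`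
(for `e ≥ 1`; for `e = 0` it is `0`). [folklore] -/
theorem apply_top_eq_zero {μ : AddMonoid.End W.geomPoints} {e : ℕ} {P : W.geomPoints}
    (he : (μ ^ e) P = 0) : μ ((μ ^ (e - 1)) P) = 0 := by
  rcases Nat.eq_zero_or_pos e with h0 | hpos
  · subst h0
    rw [pow_zero] at he
    change P = 0 at he
    rw [he, map_zero, map_zero]
  · rw [← pow_succ_apply, Nat.sub_add_cancel hpos, he]

omit [W.IsElliptic] hp in
/-- Points of the line `ker μ` are `p`-torsion (`μ² = [m]`, `|m| = p`). [folklore] -/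
theorem prime_zsmul_eq_zero_of_apply_eq_zero {μ : AddMonoid.End W.geomPoints} {m : ℤ}
    (hm : m.natAbs = p) (hμμ : ∀ P, μ (μ P) = m • P) {t : W.geomPoints} (ht : μ t = 0) :
    (p : ℤ) • t = 0 := by
  have h0 : m • t = 0 := by rw [← hμμ, ht, map_zero]
  rcases Int.natAbs_eq m with h | h
  · rw [← hm, ← h]; exact h0
  · rw [show (p : ℤ) = -m by omega, neg_smul, h0, neg_zero]

variable {ι : Type*} [Fintype ι]

omit [W.IsElliptic] in
/-- **The relation module of the top functionals is stable under the parity twist `(−1)^{e_i−1}`**: conjugate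
a relation by an `𝓞`-antilinear `g ∈ Γ_K` (`pow_top_conj_eq_of_smul_sqrt_eq_neg`) and cancel `res g`.
[cite: GrossLMS1991, §9 (pairing after Prop. 9.1)] -/
theorem sum_top_twist_parity {s : AlgebraicClosure ℚ} {μ : AddMonoid.End W.geomPoints}
    (hanti : ∀ g : absoluteGaloisGroup ℚ, g • s = -s → ∀ P, μ (g • P) = -(g • μ P))
    (n : ℤ) (xs : ι → galH1Torsion (W.baseChange K) n) (e : ι → ℕ)
    {g : absoluteGaloisGroup K} (hg : absGaloisRestrict ℚ K g • s = -s) (b : ι → ℤ)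
    (hb : ∀ ρ ∈ torsionFixing (W.baseChange K) n,
      ∑ i, b i • (μ ^ (e i - 1)) ((RatClosure.torsionEquiv (K := K) W n).symm
        (h1Eval (W.baseChange K) n (xs i) ρ) : W.geomPoints) = 0)
    {ρ : absoluteGaloisGroup K} (hρ : ρ ∈ torsionFixing (W.baseChange K) n) :
    ∑ i, (b i * (-1) ^ (e i - 1)) • (μ ^ (e i - 1)) ((RatClosure.torsionEquiv (K := K) W n).symm
        (h1Eval (W.baseChange K) n (xs i) ρ) : W.geomPoints) = 0 := by
  have hρ' : g * ρ * g⁻¹ ∈ torsionFixing (W.baseChange K) n :=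
    (torsionFixing_normal (W.baseChange K) n).conj_mem ρ hρ g
  have h := hb _ hρ'
  simp_rw [pow_top_conj_eq_of_smul_sqrt_eq_neg W hanti n _ hg hρ, smul_smul] at h
  -- `h : ∑ (b_i (−1)^{e_i−1}) • (res g • T_i ρ) = 0`; pull `res g` out
  set φ := DistribSMul.toAddMonoidHom W.geomPoints (absGaloisRestrict ℚ K g) with hφ
  have h' : φ (∑ i, (b i * (-1) ^ (e i - 1)) • (μ ^ (e i - 1))
      ((RatClosure.torsionEquiv (K := K) W n).symm (h1Eval (W.baseChange K) n (xs i) ρ) :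
        W.geomPoints)) = 0 := by
    rw [map_sum]
    simpa only [map_zsmul, hφ, DistribSMul.toAddMonoidHom_apply] using h
  rwa [hφ, DistribSMul.toAddMonoidHom_apply, smul_eq_zero_iff_eq] at h'

omit [W.IsElliptic] in
/-- **The relation module of the top functionals is stable under the twist `ν_i (−1)^{e_i−1}`**: conjugate a
relation by complex conjugation (`pow_top_conjGalCMH_eq_of_eigen`), use `c₀ = η` on the line and cancel.
[cite: McCallumLMS1991, §3 proof of Prop. 3.1] -/
theorem sum_top_twist_sign_parity {s : AlgebraicClosure ℚ} {μ : AddMonoid.End W.geomPoints}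
    (hs : s ^ 2 = ((-(p : ℤ) : ℤ) : AlgebraicClosure ℚ))
    (hanti : ∀ g : absoluteGaloisGroup ℚ, g • s = -s → ∀ P, μ (g • P) = -(g • μ P))
    {c : K ≃ₐ[ℚ] K} {c₀ : absoluteGaloisGroup ℚ} (hc₀ : IsComplexConjugation (Rat.castHom ℝ) c₀)
    (ht : IsLiftOfAut c (absGaloisTransport (K := ℚ) (L := K) c₀).toRingEquiv)
    {η : ℤ} (hηs : η = 1 ∨ η = -1) (hη : ∀ P : W.geomPoints, μ P = 0 → c₀ • P = η • P)
    (n : ℤ) (xs : ι → galH1Torsion (W.baseChange K) n) {ν : ι → ℤ} (hν : ∀ i, ν i = 1 ∨ ν i = -1)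
    (hxs : ∀ i, conjAct W c n (xs i) = ν i • xs i) (e : ι → ℕ)
    (he : ∀ i, ∀ ρ ∈ torsionFixing (W.baseChange K) n,
      (μ ^ e i) ((RatClosure.torsionEquiv (K := K) W n).symm
        (h1Eval (W.baseChange K) n (xs i) ρ) : W.geomPoints) = 0)
    (b : ι → ℤ)
    (hb : ∀ ρ ∈ torsionFixing (W.baseChange K) n,
      ∑ i, b i • (μ ^ (e i - 1)) ((RatClosure.torsionEquiv (K := K) W n).symm
        (h1Eval (W.baseChange K) n (xs i) ρ) : W.geomPoints) = 0)
    {ρ : absoluteGaloisGroup K} (hρ : ρ ∈ torsionFixing (W.baseChange K) n) :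
    ∑ i, (b i * (ν i * (-1) ^ (e i - 1))) • (μ ^ (e i - 1)) ((RatClosure.torsionEquiv (K := K) W n).symm
        (h1Eval (W.baseChange K) n (xs i) ρ) : W.geomPoints) = 0 := by
  have hinv : ∀ y, (absGaloisTransport (K := ℚ) (L := K) c₀).toRingEquiv
      ((absGaloisTransport (K := ℚ) (L := K) c₀).toRingEquiv y) = y := fun y ↦
    RatClosure.absGaloisTransport_absGaloisTransport_of_sq_eq_one hc₀.sq_eq_one y
  have hρ' : ht.conjGalCMH ρ ∈ torsionFixing (W.baseChange K) n :=
    ht.conjGalCMH_mem_torsionFixing W hinv n hρ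
  have h := hb _ hρ'
  -- rewrite each term: `T_i(ρ^τ) = (ν_i (−1)^{e_i−1}) • η • T_i ρ`
  have hterm : ∀ i, (μ ^ (e i - 1)) ((RatClosure.torsionEquiv (K := K) W n).symm
      (h1Eval (W.baseChange K) n (xs i) (ht.conjGalCMH ρ)) : W.geomPoints) =
      (ν i * (-1) ^ (e i - 1) * η) • (μ ^ (e i - 1)) ((RatClosure.torsionEquiv (K := K) W n).symm
        (h1Eval (W.baseChange K) n (xs i) ρ) : W.geomPoints) := by
    intro i
    rw [pow_top_conjGalCMH_eq_of_eigen W p hs hanti hc₀ ht n (hν i) (hxs i) hρ,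
      hη _ (apply_top_eq_zero W (he i ρ hρ)), smul_smul]
  -- `h : ∑ b_i • T_i(ρ^τ) = 0` with `T_i(ρ^τ) = (ν_i (−1)^{e_i−1} η) • T_i ρ`; cancel `η` (`η² = 1`)
  have hηη : η * η = 1 := by rcases hηs with rfl | rfl <;> norm_num
  have key : η • ∑ i, (b i * (ν i * (-1) ^ (e i - 1))) • (μ ^ (e i - 1))
      ((RatClosure.torsionEquiv (K := K) W n).symm (h1Eval (W.baseChange K) n (xs i) ρ) :
        W.geomPoints) = 0 := by
    rw [Finset.smul_sum, ← h]
    refine Finset.sum_congr rfl fun i _ ↦ ?_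
    rw [hterm i, smul_smul, smul_smul]
    congr 1
    ring
  have h1 : (η * η) • ∑ i, (b i * (ν i * (-1) ^ (e i - 1))) • (μ ^ (e i - 1))
      ((RatClosure.torsionEquiv (K := K) W n).symm (h1Eval (W.baseChange K) n (xs i) ρ) :
        W.geomPoints) = 0 := by
    rw [mul_smul, key, smul_zero]
  rwa [hηη, one_smul] at h1

omit [W.IsElliptic] in
/-- **Every relation among top functionals restricts to each (parity, sign) class.**
[cite: McCallumLMS1991, §3 proof of Prop. 3.1] -/
theorem sum_top_class_eq_zero {s : AlgebraicClosure ℚ} {μ : AddMonoid.End W.geomPoints} {m : ℤ}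
    (hs : s ^ 2 = ((-(p : ℤ) : ℤ) : AlgebraicClosure ℚ)) (hm : m.natAbs = p)
    (hμμ : ∀ P, μ (μ P) = m • P)
    (hanti : ∀ g : absoluteGaloisGroup ℚ, g • s = -s → ∀ P, μ (g • P) = -(g • μ P))
    (hp2 : p ≠ 2) {g : absoluteGaloisGroup K} (hg : absGaloisRestrict ℚ K g • s = -s)
    {c : K ≃ₐ[ℚ] K} {c₀ : absoluteGaloisGroup ℚ} (hc₀ : IsComplexConjugation (Rat.castHom ℝ) c₀)
    (ht : IsLiftOfAut c (absGaloisTransport (K := ℚ) (L := K) c₀).toRingEquiv)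
    {η : ℤ} (hηs : η = 1 ∨ η = -1) (hη : ∀ P : W.geomPoints, μ P = 0 → c₀ • P = η • P)
    (n : ℤ) (xs : ι → galH1Torsion (W.baseChange K) n) {ν : ι → ℤ} (hν : ∀ i, ν i = 1 ∨ ν i = -1)
    (hxs : ∀ i, conjAct W c n (xs i) = ν i • xs i) (e : ι → ℕ)
    (he : ∀ i, ∀ ρ ∈ torsionFixing (W.baseChange K) n,
      (μ ^ e i) ((RatClosure.torsionEquiv (K := K) W n).symm
        (h1Eval (W.baseChange K) n (xs i) ρ) : W.geomPoints) = 0)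
    {a : ι → ℤ}
    (ha : ∀ ρ ∈ torsionFixing (W.baseChange K) n,
      ∑ i, a i • (μ ^ (e i - 1)) ((RatClosure.torsionEquiv (K := K) W n).symm
        (h1Eval (W.baseChange K) n (xs i) ρ) : W.geomPoints) = 0)
    {α β : ℤ} (hα : α = 1 ∨ α = -1) (hβ : β = 1 ∨ β = -1)
    {ρ : absoluteGaloisGroup K} (hρ : ρ ∈ torsionFixing (W.baseChange K) n) :
    ∑ i, (if (-1 : ℤ) ^ (e i - 1) = α ∧ ν i = β then a i else 0) •
      (μ ^ (e i - 1)) ((RatClosure.torsionEquiv (K := K) W n).symm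
        (h1Eval (W.baseChange K) n (xs i) ρ) : W.geomPoints) = 0 := by
  have hpodd : Odd p := hp.out.odd_of_ne_two hp2
  -- the functionals on the subtype `Γ_{K(W[n])}`
  set T : ι → torsionFixing (W.baseChange K) n → W.geomPoints := fun i ρ ↦
    (μ ^ (e i - 1)) ((RatClosure.torsionEquiv (K := K) W n).symm
      (h1Eval (W.baseChange K) n (xs i) ρ) : W.geomPoints) with hT
  have hTp : ∀ i (ρ : torsionFixing (W.baseChange K) n), (p : ℤ) • T i ρ = 0 := fun i ρ ↦
    prime_zsmul_eq_zero_of_apply_eq_zero W p hm hμμ (apply_top_eq_zero W (he i ρ ρ.2))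
  have hlab₁ : ∀ i, (-1 : ℤ) ^ (e i - 1) = 1 ∨ (-1 : ℤ) ^ (e i - 1) = -1 := fun i ↦
    neg_one_pow_eq_or ℤ _
  -- twist stability: parity, and sign = (sign·parity)·parity
  have htw₁ : ∀ b : ι → ℤ, (∀ ρ : torsionFixing (W.baseChange K) n, ∑ i, b i • T i ρ = 0) →
      ∀ ρ : torsionFixing (W.baseChange K) n, ∑ i, (b i * (-1) ^ (e i - 1)) • T i ρ = 0 :=
    fun b hb ρ ↦ sum_top_twist_parity W hanti n xs e hg b (fun ρ hρ ↦ hb ⟨ρ, hρ⟩) ρ.2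
  have htw₂ : ∀ b : ι → ℤ, (∀ ρ : torsionFixing (W.baseChange K) n, ∑ i, b i • T i ρ = 0) →
      ∀ ρ : torsionFixing (W.baseChange K) n, ∑ i, (b i * ν i) • T i ρ = 0 := by
    intro b hb ρ
    have h1 : ∀ ρ : torsionFixing (W.baseChange K) n,
        ∑ i, (b i * (ν i * (-1) ^ (e i - 1))) • T i ρ = 0 := fun ρ ↦
      sum_top_twist_sign_parity W p hs hanti hc₀ ht hηs hη n xs hν hxs e he b (fun ρ hρ ↦ hb ⟨ρ, hρ⟩) ρ.2
    have h2 := htw₁ _ h1 ρ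
    convert h2 using 2 with i
    congr 1
    rw [mul_assoc, mul_assoc, ← pow_add, ← two_mul, pow_mul, neg_one_sq, one_pow, mul_one]
  exact sum_class_eq_zero p hpodd T hTp hlab₁ hν htw₁ htw₂ (a := a) (fun ρ ↦ ha ρ ρ.2) hα hβ ⟨ρ, hρ⟩

end Tops

end Summit.BirchSwinnertonDyer.BirchSwinnertonDyer.Theorems.PrintCFram.BorelKolyvaginPairing

end
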